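import Summits.QuantumFields.YangMills.Theorems.BalabanUVNodesN11NodeFacesOfSupplyChainTokens
import Literature.MathematicalPhysics.QuantumFieldTheory.Balaban1983to89.Node00.Record13SepCoPHChi
import Literature.MathematicalPhysics.QuantumFieldTheory.Balaban1983to89.Node00.Record13ResidualsRChi
import Summits.QuantumFields.YangMills.Theorems.BalabanUVNodesN11HistoryPinnedResidualDefsChi
import Summits.QuantumFields.YangMills.Theorems.BalabanUVNodesN11RePinnedParamDefsChi
import Summits.QuantumFields.YangMills.Theorems.BalabanUVNodesN11NoExpansionAtRecord13CoPChi
import Summits.QuantumFields.YangMills.Theorems.BalabanUVNodesN11NoExpansionDiagonalCoPHChi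
import Summits.QuantumFields.YangMills.Theorems.BalabanUVNodesN11BackgroundScaleLocalChi
import Summits.QuantumFields.YangMills.Theorems.BalabanUVNodesN11Sect3SupplyPresentParentsChi
import Summits.QuantumFields.YangMills.Theorems.BalabanUVNodesN11NoExpansionOldFactorsChi
import Summits.QuantumFields.YangMills.Theorems.BalabanUVNodesN11NoExpansionGeneralStepCoPHOldBranchChi
import Summits.QuantumFields.YangMills.Theorems.BalabanUVNodesN11NoExpansionGeneralStepLawsCoPHChi
import Summits.QuantumFields.YangMills.Theorems.BalabanUVNodesN11NoExpansionGeneralStepGraphChi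
import Summits.QuantumFields.YangMills.Theorems.BalabanUVNodesN11DiagonalOldBranchMeasurableChi
import Summits.QuantumFields.YangMills.Theorems.BalabanUVNodesN11OldBranchPairChi
import Summits.QuantumFields.YangMills.Theorems.BalabanUVNodesN11TruncationDominationChi
import Summits.QuantumFields.YangMills.Theorems.BalabanUVNodesN11Sect3SupplySplicePairChi
import Summits.QuantumFields.YangMills.Theorems.BalabanUVNodesN11Sect3SupplyChainDefsChi
import Summits.QuantumFields.YangMills.Theorems.BalabanUVNodesN11Sect3SupplyChainChi
import Summits.QuantumFields.YangMills.Theorems.BalabanUVNodesN11GaussianCertificateRowsChi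
import Summits.QuantumFields.YangMills.Theorems.BalabanUVNodesN11GaussianCertificateDefsChi
import Summits.QuantumFields.YangMills.Theorems.BalabanUVNodesN11Sect3SupplyChainObligationsPairChi
import Literature.MathematicalPhysics.QuantumFieldTheory.Balaban1983to89.B16RLeafRecord13LiveCoPHChi
import Summits.QuantumFields.YangMills.Theorems.BalabanUVNodesN11K1CeilingFreeOfSupplyChainChi

/-!
# χ-GENERIC RE-ISSUE (WORK ORDER RC-1 «RE-CENTRE THE RECORD», director-ym №462 (B) ∕ №467 (D)) of `BalabanUVNodesN11NodeFacesOfSupplyChainTokens`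

Cell `pub-ymgap` (HUMAN RULING D-0062, Track A), seat `pub-ymgap-dag-n11-d` (N11 [B14] s2; N11-σ campaign, `N11-G44-RC1-REACH-CENSUS.md`).  The CENTRE-TYPED
declarations of `BalabanUVNodesN11NodeFacesOfSupplyChainTokens` (those whose statement reads the (2.9) cut-off centre through `gOfRecord₁₃ ∕ EOfRecord₁₃ ∕ Provisos₁₃… ∕ T∕SLaw₁₃… ∕
UbgOfRecord₁₃… ∕ WtOfRecord₁₃… ∕ datum∕tower∕coreOfRecord₁₃…`) RE-ISSUED VERBATIM in the β-slot `χ : ChiSlot F N` over [Ax-3b]∕[Ax-3c]∕[Ax-3d]'s χ-generic carriers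
(`Node00/Record13Chi` ∕ `Record13CoPHChi` ∕ `Record13SepCoPHChi`): σ = (binder `(χ : ChiSlot F N)` after `θ`; Node00 defs `X ↦ XChi … χ`; Node00 rows `Y ↦ Y_chi`;
this lane's sibling modules `…Chi` for Summits-side dependencies); SAME short names in the sibling namespace `…BalabanUVNodesN11NodeFacesOfSupplyChainTokensChi` (consumers switch by namespace);
the 9 centre-FREE declarations of the original are NOT copied — they are reused BY NAME (`open … (…)` below).  At `χ := chiβOfRecord₁₃ θ` every statement here is
DEFINITIONALLY the landed one ([Ax-3b]'s `rfl` receipts); at `χ := chiβOfRecord₁₃Ax θ` it is what the Ax-record's N11 machine reads.  Nothing of record edited (body-freeze №460 (2)).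

HONEST FRAMING.  Count-neutral kernel re-elaboration of landed N11 bookkeeping∕estimates in a parameter; every HYPOTHESIS of the original stays a hypothesis; nothing of
Bałaban asserted beyond what the original file proves; N11 NOT discharged; K-items untouched; counts unmoved.  One finite `𝕋⁴_{L^K}` programme at fixed `ε = L^{−K}` —
NOT ℝ⁴, NOT OS, NOT a mass gap, NOT Clay.  No `sorry`∕`instance`∕`notation`.  Sources: as the original module, plus [I] = [Balaban1987RG1] (2.9) p.266 (the cut-off's centre).
-/

noncomputable section

open MeasureTheory TopologicalSpace
open scoped BigOperators ENNReal NNReal Matrix.Norms.L2Operator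

namespace Summit.QuantumFields.YangMills.Theorems.BalabanUVNodesN11NodeFacesOfSupplyChainTokensChi

open Summit.QuantumFields.YangMills.Theorems.BalabanUVNodesN11NodeFacesOfSupplyChainTokens (b14_main_leavesP_all_of_supplyChainAt_family nodes_leavesP_withCeiling_of_supplyChainAt_family thm1Printed_datumOfRecord₁₃CoPH_of_supplyChainAt_family thm1Printed_datumOfRecord₁₃SepCoPH_of_supplyChainAt_family rung1At_withCeiling_of_supplyChainAt_family supplyChainAt_family_of_gaussCert_of_continuous b14_main_leavesP_all_of_gaussCert_of_continuous thm1Printed_datumOfRecord₁₃SepCoPH_of_gaussCert_of_continuous h11Family_of_gaussCert_of_continuous)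
open Literature.MathematicalPhysics.QuantumFieldTheory.Balaban1983to89 T4Continuum T4NestedCovariance Node00 Node00.Tk DagBinding
open B15DeterminingSets B8Eq17ClassAkV1 B14.Eq218Concrete B10Eq42TorusConstraint Step
open Literature.MathematicalPhysics.QuantumFieldTheory.Balaban1983to89.B16RLeafRecord13LiveCoPHChi (rOpLeaf_VOfRecord₁₃CoPH_of_liveSel_of_rstep)
open Summit.QuantumFields.YangMills.Theorems.StabilityBAtRecordR13SepCoPH.Negative.SignBoxAtEveryWitnessFalse (withCeiling Rung1At)
open BalabanUVNodesN11HistoryPinnedResidualDefs hiding IsNoExpHistAt ZhPinOfRecord₁₃ ZhPinOfRecord₁₃_quad ZhPinOfRecord₁₃_ζ0_empty_of_hist ZhPinOfRecord₁₃_ζ0_of_hist_of_ne_of_ne ZhPinOfRecord₁₃_ζ0_of_not ZhPinOfRecord₁₃_ζ0_seqAllLarge ZhPinOfRecord₁₃_ζ0_univ_of_hist finsum_ζ0_ZhPinOfRecord₁₃ histPinOfRecord₁₃ histPinOfRecord₁₃_le_one histPinOfRecord₁₃_local histPinOfRecord₁₃_nonneg histPinOfRecord₁₃_pairCfg histPinOfRecord₁₃_pairCfgAt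 histPinOfRecord₁₃_seqAllLarge isNoExpHistAt_restrict isNoExpHistAt_self laws_ZhPinOfRecord₁₃ localLaws_ZhPinOfRecord₁₃
open BalabanUVNodesN11HistoryPinnedResidualDefsChi
open BalabanUVNodesN11RePinnedParamDefs hiding rePinH zhAt_rePinH zhAt_rePinH_eq_init_of_Omega_empty zhAt_rePinH_ζ0_univ_pairCfgAt zhUnity_rePinH
open BalabanUVNodesN11RePinnedParamDefsChi
open BalabanUVNodesN11Sect3SupplyChainDefs hiding NewEClausesAt NoExpansionClauseFor PresentChildObligations Sect3Supplier baseWitness baseWitness_form chainWitness isFluctLocal_baseWitness isFluctLocal_chainWitness isFluctLocal_spliceTermsB spliceConst spliceConst_of_Omega_empty spliceConst_of_Omega_ne spliceTermsB spliceTermsB_E spliceTermsB_of_Omega_empty spliceTermsB_of_absent spliceTermsB_of_present universalE_spliceTermsB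
open BalabanUVNodesN11Sect3SupplyChainDefsChi
open BalabanUVNodesN11Sect3SupplyChainObligationsDefs hiding ChainFormAt ChainFormTAt NoExpansionObligation OperandRowsAlongChain OperandRowsAt SupplierObligations SupplyChainAt chainFormAt_all_of_obligations chainFormTAt_all_of_obligations chainFormTAt_of_chainFormAt noExpansionObligation_of_gaussCert_of_operandRows tLaw₁₃CoPH_all_of_obligations tLaw₁₃CoPH_of_chainFormTAt thmP245Laws_of_obligations thmP245Laws_of_supplyChainAt
open BalabanUVNodesN11Sect3SupplyChainObligationsDefsChi
open BalabanUVNodesN11SupplierRowsOfContinuous (supplyChainAt_of_gaussCert_of_continuous)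
open BalabanUVNodesN11K1CeilingFreeOfSupplyChain (b14_main_leavesP_of_supplyChainAt_of_window nodes_leavesP_withCeiling_of_b14_main rung1At_withCeiling_of_supplyChainAt)

variable {F : T4Family} {N : ℕ} [NeZero N]

/-! ## §1  The road-agnostic sockets: node faces from a family of tokens on the Step window -/

section Sockets

variable (θ : Stage13HParams F N) (χ : ChiSlot F N)

/-- **THE WINDOW TRANSFER** (`≤` form of H5's `step_inInterval_top_of_flow_inInterval_min`): the couplings of the CoPH datum of `θ` along a run `P` ARE the record's
`gOfRecord₁₃ θ P` (`rfl`), so a datum-flow window `]0, γ′]` with `γ′ ≤ γ` is a Step window `]0, γ]` of the record's couplings. [cite: Balaban1987RG1, (0.20) p.256; Balaban1988Convergent, p.244 (bookkeeping)] -/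
theorem step_inInterval_gOfRecord_of_flow_inInterval_of_le (h : θ.Provisos₁₃CoPHChi F N χ) {γ' γ : ℝ} (hle : γ' ≤ γ) {P : B12.RunParams}
    (hP : ((datumOfRecord₁₃CoPHChi F N θ χ h).C P).flow.InInterval γ' P.K) : Step.InInterval γ P.K (gOfRecord₁₃Chi F N θ.toStage13Params χ P) :=
  fun j hj => ⟨(hP j hj).1, (hP j hj).2.trans hle⟩

/-- **★★★ N11's CHILD FAMILY IN THE `h11` SHAPE OF THE K1⁹-BY-NAME ROAD (dag-n24-c `…K1R9ByName…`, binder `h11` VERBATIM up to the choice of `θ`) FROM A FAMILY OF TOKENS ON THE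
STEP WINDOW `]0, γ]`, `0 < γ`**: for every `(βup, β₀)`, with `γ₁₁ := γ`, at EVERY world `w` bound to the SepCoPH datum of `θ` with `w.βup = βup`, `w.β₀ = β₀`, `w.γ ≤ γ₁₁`, for
EVERY run, under the node's own leaf antecedents, the (S1ᵀ) slot `∀ k < K, SLaw₁₃CoPH θ P k → TLaw₁₃CoPH θ P k` — of the antecedents ONLY `smallCouplings` is read (it is the window
of the record's couplings, transferred by §1); `βup ∕ β₀ ∕ b7…b11 ∕ smallFieldInductive ∕ flowControl` UNREAD.  ROAD-AGNOSTIC socket for the K1 road's N11 binder.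
[cite: Balaban1988Convergent, Theorem p.245, Thm 1 p.262, remark p.262, p.244 L36–38, §3 p.279, (2.6) p.255; Balaban1989LargeFieldII, Thm 1 + (0.1) pp.355–356; Balaban1989LargeFieldI, (0.3)–(0.4) p.176, p.177 (i)–(ii)] -/
theorem h11Family_of_supplyChainAt_family (h : θ.Provisos₁₃SepCoPHChi F N χ)
    (hsel : θ.ppSel = ppSelLiveOfRecord F N θ.ν θ.τ9 (EOfRecord₁₃Chi F N θ.toStage13Params χ) (wOfRecord₉ F N θ.toStage9Params))
    (hθ : θ.Admissible F N) (hκ : 0 ≤ θ.s2.lf.κ) (hE₀ : 0 ≤ θ.s2.lf.E₀) (hB₀ : 0 ≤ θ.s2.lf.B₀) (hM : 1 ≤ θ.τ9.M) {γ : ℝ} (hγ : 0 < γ)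
    (hN : ∀ P : B12.RunParams, Step.InInterval γ P.K (gOfRecord₁₃Chi F N θ.toStage13Params χ P) → SupplyChainAt θ χ P) :
    ∀ βup β₀ : ℝ, ∃ γ₁₁ : ℝ, 0 < γ₁₁ ∧ ∀ w : WorldP, w.C = (datumOfRecord₁₃SepCoPHChi F N θ χ h).C → w.βup = βup → w.β₀ = β₀ → w.γ ≤ γ₁₁ →
      ∀ P : B12.RunParams, (leavesP w P).b7 → (leavesP w P).b8 → (leavesP w P).b9 → (leavesP w P).b10 → (leavesP w P).b11 →
      (leavesP w P).smallCouplings → (leavesP w P).smallFieldInductive → (leavesP w P).flowControl →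
        ∀ k, k < P.K → SLaw₁₃CoPHChi F N θ χ P k → TLaw₁₃CoPHChi F N θ χ P k := fun _ _ =>
  ⟨γ, hγ, fun w hC _ _ hγw P _ _ _ _ _ hsc _ _ =>
    have hsc' : ((datumOfRecord₁₃SepCoPHChi F N θ χ h).C P).flow.InInterval w.γ P.K := by
      have h₀ : (w.C P).flow.InInterval w.γ P.K := hsc
      rwa [hC] at h₀
    thmP245Laws_of_supplyChainAt h.toCore hsel hθ hκ hE₀ hB₀ hM (hN P (step_inInterval_gOfRecord_of_flow_inInterval_of_le θ χ h.toCore hγw hsc'))⟩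

end Sockets

/-! ## §2  `N = 2`: the rung-1 datum passes to every ceiling, from a family of tokens on the Step window -/

/-! ## §3  THE CONTINUITY ROAD: the token family, N11's node, `B16.Thm1Printed` and the `h11` family from `SupplierObligations` + continuous bounded terms -/

/-! ## v1.1 (APPEND-ONLY; dag-n11-d g44, N11-σ chain): the remaining cone declarations of this module in χ — every v1 declaration above is byte-identical -/

section V11Append

open Summit.QuantumFields.YangMills.Theorems.BalabanUVNodesN11NodeFacesOfSupplyChainTokens (rung1At_withCeiling_of_supplyChainAt_family supplyChainAt_family_of_gaussCert_of_continuous b14_main_leavesP_all_of_gaussCert_of_continuous thm1Printed_datumOfRecord₁₃SepCoPH_of_gaussCert_of_continuous h11Family_of_gaussCert_of_continuous)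
open BalabanUVNodesN11K1CeilingFreeOfSupplyChain (nodes_leavesP_withCeiling_of_b14_main rung1At_withCeiling_of_supplyChainAt)
open BalabanUVNodesN11K1CeilingFreeOfSupplyChainChi (b14_main_leavesP_of_supplyChainAt_of_window)

section
variable {F : T4Family} {N : ℕ} [NeZero N]
variable (θ : Stage13HParams F N) (χ : ChiSlot F N)

/-- **★★ N11's DAG NODE AT EVERY RUN — `∀ P, Dag.B14_main (leavesP w P)` — FROM A FAMILY OF TOKENS ON THE STEP WINDOW `]0, γ]`**, at ANY world `w` bound to the CoPH datum of
`θ` (`w.C = (datumOfRecord₁₃CoPH θ h).C`) with `w.γ ≤ γ`, on the live-selector line (core provisos, selector clause, admissibility, `0 ≤ κ ∕ E₀ ∕ B₀`, `1 ≤ M`): dag-n11-d's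
window-threaded per-run face `b14_main_leavesP_of_supplyChainAt_of_window` with the node's own `smallCouplings` window transferred (§1).  ROAD-AGNOSTIC: `hN` is what every supplier
road of the tree concludes. [cite: Balaban1988Convergent, Thm 1 p.262, Theorem p.245, p.244 L36–38, §3 p.279; Balaban1989LargeFieldII, Introduction pp.355–356; Balaban1989LargeFieldI, (0.3)–(0.4) p.176, p.177 (i)–(ii)] -/
theorem b14_main_leavesP_all_of_supplyChainAt_family (h : θ.Provisos₁₃CoPHChi F N χ)
    (hsel : θ.ppSel = ppSelLiveOfRecord F N θ.ν θ.τ9 (EOfRecord₁₃Chi F N θ.toStage13Params χ) (wOfRecord₉ F N θ.toStage9Params))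
    (hθ : θ.Admissible F N) (hκ : 0 ≤ θ.s2.lf.κ) (hE₀ : 0 ≤ θ.s2.lf.E₀) (hB₀ : 0 ≤ θ.s2.lf.B₀) (hM : 1 ≤ θ.τ9.M) {γ : ℝ}
    (hN : ∀ P : B12.RunParams, Step.InInterval γ P.K (gOfRecord₁₃Chi F N θ.toStage13Params χ P) → SupplyChainAt θ χ P)
    (w : WorldP) (hC : w.C = (datumOfRecord₁₃CoPHChi F N θ χ h).C) (hγw : w.γ ≤ γ) : ∀ P : B12.RunParams, Dag.B14_main (leavesP w P) := fun P =>
  b14_main_leavesP_of_supplyChainAt_of_window h hsel hθ hκ hE₀ hB₀ hM w hC fun hw =>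
    hN P (step_inInterval_gOfRecord_of_flow_inInterval_of_le θ χ h hγw hw)

end

section
variable {F : T4Family} {N : ℕ} [NeZero N]
variable (θ : Stage13HParams F N) (χ : ChiSlot F N)

/-- **★★ THE THIRTEEN DAG NODES PASS TO EVERY CEILING, FROM A FAMILY OF TOKENS ON THE STEP WINDOW** — nodes at `w` (bound to the CoPH datum, `w.γ ≤ γ`) ⇒ nodes at
`withCeiling w c` for EVERY real `c`: dag-n11-d g14 §1 (`nodes_leavesP_withCeiling_of_b14_main`; `withCeiling` keeps `C` and `γ`, `rfl`) over the node family above.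
[cite: Balaban1989LargeFieldII, Introduction pp.355–356 (the citation DAG); Balaban1988Convergent, Thm 1 p.262, (2.6) p.255 (bookkeeping)] -/
theorem nodes_leavesP_withCeiling_of_supplyChainAt_family (h : θ.Provisos₁₃CoPHChi F N χ)
    (hsel : θ.ppSel = ppSelLiveOfRecord F N θ.ν θ.τ9 (EOfRecord₁₃Chi F N θ.toStage13Params χ) (wOfRecord₉ F N θ.toStage9Params))
    (hθ : θ.Admissible F N) (hκ : 0 ≤ θ.s2.lf.κ) (hE₀ : 0 ≤ θ.s2.lf.E₀) (hB₀ : 0 ≤ θ.s2.lf.B₀) (hM : 1 ≤ θ.τ9.M) {γ : ℝ}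
    (hN : ∀ P : B12.RunParams, Step.InInterval γ P.K (gOfRecord₁₃Chi F N θ.toStage13Params χ P) → SupplyChainAt θ χ P)
    (w : WorldP) (hC : w.C = (datumOfRecord₁₃CoPHChi F N θ χ h).C) (hγw : w.γ ≤ γ) (hn : ∀ P : B12.RunParams, Nodes (leavesP w P)) (c : ℝ) :
    ∀ P : B12.RunParams, Nodes (leavesP (withCeiling w c) P) := fun P =>
  nodes_leavesP_withCeiling_of_b14_main w c P (hn P) (b14_main_leavesP_all_of_supplyChainAt_family θ χ h hsel hθ hκ hE₀ hB₀ hM hN (withCeiling w c) hC hγw P)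

end

end V11Append

end Summit.QuantumFields.YangMills.Theorems.BalabanUVNodesN11NodeFacesOfSupplyChainTokensChi

end

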